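import Literature.MathematicalPhysics.QuantumFieldTheory.Balaban1983to89.B11LeafKnit
import Literature.MathematicalPhysics.QuantumFieldTheory.Balaban1983to89.B8Thm2AtConstants

/-!
# `Balaban1983to89.B11LeafKnitB8Edge` — T. Bałaban, *The variational problem and background fields in renormalization group method for
# lattice gauge theories*, Commun. Math. Phys. **102** (1985) 277–309 [Balaban1985Variational], with [Balaban1985RegularSpaces] (= its
# ref. [6]), Commun. Math. Phys. **99** (1985) 75–102: **the in-edge b8 → b11 of the DAG node N07 AT CONSTANTS** — Proposition 2 (p. 281) of
# [Balaban1985Variational] at B₁ = 5dLB₀ («we have B₁ = 5dLB₀», p. 296 = [6] Prop. 3 p. 87) from the `b8` leaf's Theorem 4 / Proposition 3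
# BODIES through the p. 88 reduction «Theorem 4 + Proposition 3 + (1.65) ⇒ Theorem 2» at explicit constants
# (`B8Thm2AtConstants.thm2ExistsAt_of_bodies`, seat dag-n05-a) and the bridges of pp. 280–281 (`B11Prop2Assembly`), plus the monotonicity
# of Proposition 2 in (B₁, c₁) that lets a pin of the B11 constants absorb [6]'s thresholds

statement-level bookkeeping over published theorems with citation tags; proofs = kernel composition of landed modules BY NAME; nothing here
is a claim about the Yang–Mills mass gap

PDF held: `paper:balaban1985-cmp102-variational-background` (journal page = PDF page + 276); `paper:balaban1985-cmp99-regular-spaces`.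

CITATION HEADER (lean-in-tree rule 2026-08-18) / WHAT IS REPRODUCED.  Cell `pub-ymgap`, Track A node N07 = [B11] (`Dag.B11_main` = «b5 → b6 →
b7 → b8 → b9 → b11»), prover seat `pub-ymgap-dag-n07-a` (KNIT-BY-NAME), fifth module; answers the seat's interface finding F1 (dossier
`HOME/pub-ymgap-dag-n07-a/N07-KNIT.md`; dag-n05-a's [DAGN05A-G0-LANDED-2]) — `DagBinding.B11Leaf Z` fixes [6]'s constants B₁, c₁ as FIELDS of
`Z` while the `b8` leaf `DagBinding.B8LeafR` quantifies Theorem 2's constants existentially.  A NEW LEAF over the seat's `B11LeafKnit` and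
dag-n05-a's `B8Thm2AtConstants`; nothing there is modified; NO definition is introduced (theorems only).
§1 `prop2Printed_mono`: `B11.Prop2Printed B₁ B₃ C₁ c₁` is MONOTONE in B₁ and ANTITONE in c₁ (B₁ enters only through «ε₂ ≧ B₁(ε₀ + C₁ε₁)»,
   c₁ only through «ε₀ + C₁ε₁ ≤ c₁» — no carrier law); `prop2_of_b8_mono`: from the node's own antecedent `b8` ([6] Thm 2 with ∃-constants
   B₁⁶, c₁⁶) Proposition 2 at EVERY (B₁′, c₁′) with B₁′ ≥ B₁⁶, 0 < c₁′ ≤ c₁⁶.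
§2 `prop2At_of_b8_bodies`: Proposition 2 AT B₁ = 5dLB₀ and a SCHEDULED threshold c₁ (the five inequalities of
   `B8Thm2AtConstants.thm2_schedule_of_le`) from the BODIES `B8.Thm4Body c₄ B′₁`, `B8.Prop3Body c₃` on the run's B8 family `X.fam8R`, the (1.65)
   law at c₀ and [6]'s displayed carrier laws (gauge invariance of 𝔄_k, (1.37) from the construction, monotonicity of (1.62)), through a
   re-indexing `φ : Z.I11 → X.I8b` and `B11Prop2Assembly.Bridge62` laws — `thm2ExistsAt_of_bodies` + `B11Prop2Assembly.prop2Printed_of_thm2_at`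
   BY NAME; `prop2_of_b8_bodies_le`: hence at the leaf's constants whenever Z.B₁ ≥ 5dLB₀ and Z.c₁ ≤ c₁.
§3 `prop2At_exists_of_b8`: from the `b8` LEAF ITSELF (its conjuncts `t4 : B8.Thm4Printed`, `p3 : B8.Prop3Printed` — ∃ thresholds) + the same
   laws: `∃ c₁ > 0, Prop2Printed (5dLB₀) Z.B₃ Z.C₁ c₁ Z.famLG` — B₁ EXPLICIT, only the threshold existential
   (`B8Thm2AtConstants.thm2_schedule_threshold_exists`); so a pin may set Z.B₁ := max{5dLB₀, …} outright and Z.c₁ by choice on this ∃.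
§4 `b11_main_of_parts_b8bodies`: the node `Dag.B11_main (leavesP w P)` at a run `w.up P = Upstream.ofPrintedAllXPN X Y Z V W` with p2 SUPPLIED
   BY THE B8 SIDE (bodies at explicit thresholds on `X.fam8R`, Z.B₁ ≥ 5dLB₀, Z.c₁ ≤ c₁) and the other parts as in `B11LeafKnit.b11_main_of_parts`.
HONEST SCOPE.  Theorem 4, Proposition 3, (1.65) of [6] and Props 3–6, 8, Sect. F, Prop 9 of [Balaban1985Variational] are INPUTS (typed
statements ∕ bodies ∕ located laws, never asserted); the schedule's threshold is sub-cell b08's bookkeeping (census C-B8-12), not a printed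
number.  Count-neutral Track-A bookkeeping; NOT a discharge of N05 or N07 (the B8 and B11 groups are FREE at NODE 00 Stages 1–3); one finite T⁴
programme at fixed ε; Bałaban AS PRINTED with locators; nothing continuum ∕ ℝ⁴ ∕ OS ∕ mass-gap ∕ Clay.
-/

namespace Literature.MathematicalPhysics.QuantumFieldTheory.Balaban1983to89.B11LeafKnitB8Edge

open Literature.MathematicalPhysics.QuantumFieldTheory.Balaban1983to89
open Literature.MathematicalPhysics.QuantumFieldTheory.Balaban1983to89.B11
open Literature.MathematicalPhysics.QuantumFieldTheory.Balaban1983to89.DagBinding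
open Literature.MathematicalPhysics.QuantumFieldTheory.Balaban1983to89.B11Prop7Assembly (Bridge ExistenceLeavesCap)
open Literature.MathematicalPhysics.QuantumFieldTheory.Balaban1983to89.B11Prop2Assembly (Bridge62)

variable {I : Type}

/-! ## §1. Monotonicity of Proposition 2 in (B₁, c₁); the antecedent b8 up to constants -/

/-- **`B11.Prop2Printed B₁ B₃ C₁ c₁` is monotone in B₁ and antitone in c₁** (for C₁ ≥ 0): B₁ enters only through the hypothesis
«ε₂ ≧ B₁(ε₀ + C₁ε₁)» (p. 281) and c₁ only through «ε₀ + C₁ε₁ ≤ c₁» (p. 280) — pure bookkeeping, no carrier law.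
[cite: Balaban1985Variational, Prop. 2 p.281; p.280] -/
theorem prop2Printed_mono {fam : I → LGData} {B₁ B₁' B₃ C₁ c₁ c₁' : ℝ} (hC₁ : 0 ≤ C₁) (hB : B₁ ≤ B₁') (hc : c₁' ≤ c₁)
    (h : Prop2Printed B₁ B₃ C₁ c₁ fam) : Prop2Printed B₁' B₃ C₁ c₁' fam := by
  intro i ε₀ ε₁ ε₂ hε₀ hε₁ hsum hε₂ V U₀ h14 U' h18 hcrit
  refine h i ε₀ ε₁ ε₂ hε₀ hε₁ (hsum.trans hc) ?_ V U₀ h14 U' h18 hcrit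
  have h0 : 0 ≤ ε₀ + C₁ * ε₁ := by positivity
  exact (mul_le_mul_of_nonneg_right hB h0).trans hε₂

section Edge

variable (X : PrintedCarriersR) (Y : PrintedCarriers9X) (Z : PrintedCarriers11) (V : PrintedCarriers14R) (W : PrintedCarriers15)

/-- **Proposition 2 at every (B₁′, c₁′) beyond [6]'s constants, from the node's own antecedent b8** (`B11LeafKnit.prop2_exists_of_b8` +
`prop2Printed_mono`): the `b8` leaf gives [6]'s B₁⁶, c₁⁶ > 0 with `Prop2Printed B₁′ Z.B₃ Z.C₁ c₁′ Z.famLG` for all B₁′ ≥ B₁⁶, c₁′ ≤ c₁⁶.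
[cite: Balaban1985Variational, Prop. 2 p.281; Balaban1985RegularSpaces, Thm 2 p.83] -/
theorem prop2_of_b8_mono (hb8 : (Upstream.ofPrintedAllXPN X Y Z V W).b8) (φ : Z.I11 → X.I8b)
    (β62 : ∀ i, Bridge62 (X.fam8R (φ i)).toGFData (Z.famLG i)) (laws62 : ∀ i, (β62 i).Laws Z.C₁ Z.B₃) (hC₁ : 0 < Z.C₁) :
    ∃ B₁ c₁ : ℝ, 0 < B₁ ∧ 0 < c₁ ∧ ∀ B₁' c₁' : ℝ, B₁ ≤ B₁' → c₁' ≤ c₁ → Prop2Printed B₁' Z.B₃ Z.C₁ c₁' Z.famLG := by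
  obtain ⟨B₁, c₁, hB₁, hc₁, h2⟩ := B11LeafKnit.prop2_exists_of_b8 X Y Z V W hb8 φ β62 laws62 hC₁
  exact ⟨B₁, c₁, hB₁, hc₁, fun B₁' c₁' hB hc => prop2Printed_mono hC₁.le hB hc h2⟩

/-! ## §2. Proposition 2 at B₁ = 5dLB₀ from [6]'s Theorem 4 / Proposition 3 BODIES on the run's B8 family -/

/-- **Proposition 2 AT B₁ = 5dLB₀ and a scheduled threshold c₁** (p. 280: *"U₁ = U′^{u⁻¹} satisfies the conditions (1.36)–(1.39) of [6]"*;
p. 296: *"we have B₁ = 5dLB₀"*): from the BODIES of [6] Theorem 4 (threshold c₄, constant B′₁) and Proposition 3 (threshold c₃) on the run's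
B8 family `X.fam8R`, the (1.65) law at c₀, [6]'s displayed carrier laws, a threshold c₁ satisfying the p. 88 schedule, and the bridges of
pp. 280–281 along `φ : Z.I11 → X.I8b` — `B8Thm2AtConstants.thm2ExistsAt_of_bodies` (dag-n05-a) into `B11Prop2Assembly.prop2Printed_of_thm2_at`.
[cite: Balaban1985Variational, Prop. 2 p.281, p.296; Balaban1985RegularSpaces, Thm 4 ⇒ Thm 2 p.88, Prop. 3 p.87] -/
theorem prop2At_of_b8_bodies (φ : Z.I11 → X.I8b) (β62 : ∀ i, Bridge62 (X.fam8R (φ i)).toGFData (Z.famLG i))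
    (laws62 : ∀ i, (β62 i).Laws Z.C₁ Z.B₃) (hC₁ : 0 < Z.C₁) {c₀ c₃ c₄ c₁ : ℝ} (hd : 1 ≤ X.d8) (hB : 0 < X.B₁')
    (hC₂ : 0 ≤ X.C₂)
    (e₀ : c₁ ≤ c₀) (e₄ : (1 + 11 * (X.d8 : ℝ) ^ 2) * c₁ ≤ c₄) (e₃ : c₁ ≤ c₃) (e₃' : X.B₁' * (1 + 11 * (X.d8 : ℝ) ^ 2) * c₁ ≤ c₃)
    (eD : (X.B₁' * (1 + 11 * (X.d8 : ℝ) ^ 2) * (2 * (1 + X.C₂) * X.B₁' * (1 + 11 * (X.d8 : ℝ) ^ 2) + 20 * X.d8) + 1) * c₁ ≤ 1)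
    (h4 : B8.Thm4Body c₄ X.B₁' (fun j : X.I8b => (X.fam8R j).toGFData))
    (h3 : B8.Prop3Body c₃ X.d8 X.L8 X.C₂ X.inp8 X.B₀β (fun j : X.I8b => (X.fam8R j).toGFData2))
    (h165 : ∀ j α₀ α₁ (U₀ : (X.fam8R j).Cfg) (U' : (X.fam8R j).Pert), 0 < α₀ → α₀ ≤ c₀ →
      (X.fam8R j).InA α₀ U₀ → (X.fam8R j).InAAx α₀ U₀ U' → (X.fam8R j).avgClose α₁ U₀ U' →
      (X.fam8R j).avgClose166 (11 * X.d8 ^ 2 * α₀ + α₁) U₀ U')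
    (hginv : ∀ j α₀ (U₀ : (X.fam8R j).Cfg) (U' : (X.fam8R j).Pert) (u : (X.fam8R j).GT),
      (X.fam8R j).InAAx α₀ U₀ U' → (X.fam8R j).InAPair α₀ U₀ ((X.fam8R j).act U' u))
    (h137 : ∀ j α₁ b s (U₀ : (X.fam8R j).Cfg) (U' : (X.fam8R j).Pert) (u : (X.fam8R j).GT), (X.fam8R j).avgClose α₁ U₀ U' →
      (X.fam8R j).Restricted U₀ u → (X.fam8R j).C162 b s U₀ ((X.fam8R j).act U' u) → (X.fam8R j).C137 α₁ U₀ ((X.fam8R j).act U' u))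
    (hmono162 : ∀ j b s b' s' (U₀ : (X.fam8R j).Cfg) (U₁ : (X.fam8R j).Pert), b * s ≤ b' * s' →
      (X.fam8R j).C162 b s U₀ U₁ → (X.fam8R j).C162 b' s' U₀ U₁) :
    Prop2Printed (5 * X.d8 * X.L8 * X.inp8.B₀) Z.B₃ Z.C₁ c₁ Z.famLG := by
  have hd' : (0 : ℝ) ≤ X.d8 := by positivity
  have hsched := B8Thm2AtConstants.thm2_schedule_of_le hd' hB hC₂ e₀ e₄ e₃ e₃' eD
  have H := B8Thm2AtConstants.thm2ExistsAt_of_bodies (fam := fun j : X.I8b => (X.fam8R j).toGFData2) hd hB h4 h3 hsched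
    h165 hginv h137 hmono162
  exact B11Prop2Assembly.prop2Printed_of_thm2_at β62 (B₂ := 5 * X.d8 * X.L8 * X.B₀β) laws62 hC₁ fun i => H (φ i)

/-- **… hence at the leaf's constants** whenever `5dLB₀ ≤ Z.B₁` and `Z.c₁ ≤ c₁` (`prop2Printed_mono`). [cite: Balaban1985Variational, Prop. 2 p.281, p.296] -/
theorem prop2_of_b8_bodies_le (φ : Z.I11 → X.I8b) (β62 : ∀ i, Bridge62 (X.fam8R (φ i)).toGFData (Z.famLG i))
    (laws62 : ∀ i, (β62 i).Laws Z.C₁ Z.B₃) (hC₁ : 0 < Z.C₁) {c₀ c₃ c₄ c₁ : ℝ} (hd : 1 ≤ X.d8) (hB : 0 < X.B₁')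
    (hC₂ : 0 ≤ X.C₂)
    (e₀ : c₁ ≤ c₀) (e₄ : (1 + 11 * (X.d8 : ℝ) ^ 2) * c₁ ≤ c₄) (e₃ : c₁ ≤ c₃) (e₃' : X.B₁' * (1 + 11 * (X.d8 : ℝ) ^ 2) * c₁ ≤ c₃)
    (eD : (X.B₁' * (1 + 11 * (X.d8 : ℝ) ^ 2) * (2 * (1 + X.C₂) * X.B₁' * (1 + 11 * (X.d8 : ℝ) ^ 2) + 20 * X.d8) + 1) * c₁ ≤ 1)
    (h4 : B8.Thm4Body c₄ X.B₁' (fun j : X.I8b => (X.fam8R j).toGFData))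
    (h3 : B8.Prop3Body c₃ X.d8 X.L8 X.C₂ X.inp8 X.B₀β (fun j : X.I8b => (X.fam8R j).toGFData2))
    (h165 : ∀ j α₀ α₁ (U₀ : (X.fam8R j).Cfg) (U' : (X.fam8R j).Pert), 0 < α₀ → α₀ ≤ c₀ →
      (X.fam8R j).InA α₀ U₀ → (X.fam8R j).InAAx α₀ U₀ U' → (X.fam8R j).avgClose α₁ U₀ U' →
      (X.fam8R j).avgClose166 (11 * X.d8 ^ 2 * α₀ + α₁) U₀ U')
    (hginv : ∀ j α₀ (U₀ : (X.fam8R j).Cfg) (U' : (X.fam8R j).Pert) (u : (X.fam8R j).GT),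
      (X.fam8R j).InAAx α₀ U₀ U' → (X.fam8R j).InAPair α₀ U₀ ((X.fam8R j).act U' u))
    (h137 : ∀ j α₁ b s (U₀ : (X.fam8R j).Cfg) (U' : (X.fam8R j).Pert) (u : (X.fam8R j).GT), (X.fam8R j).avgClose α₁ U₀ U' →
      (X.fam8R j).Restricted U₀ u → (X.fam8R j).C162 b s U₀ ((X.fam8R j).act U' u) → (X.fam8R j).C137 α₁ U₀ ((X.fam8R j).act U' u))
    (hmono162 : ∀ j b s b' s' (U₀ : (X.fam8R j).Cfg) (U₁ : (X.fam8R j).Pert), b * s ≤ b' * s' →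
      (X.fam8R j).C162 b s U₀ U₁ → (X.fam8R j).C162 b' s' U₀ U₁)
    (hZB₁ : 5 * X.d8 * X.L8 * X.inp8.B₀ ≤ Z.B₁) (hZc₁ : Z.c₁ ≤ c₁) :
    Prop2Printed Z.B₁ Z.B₃ Z.C₁ Z.c₁ Z.famLG :=
  prop2Printed_mono hC₁.le hZB₁ hZc₁
    (prop2At_of_b8_bodies X Z φ β62 laws62 hC₁ hd hB hC₂ e₀ e₄ e₃ e₃' eD h4 h3 h165 hginv h137 hmono162)

/-! ## §3. From the b8 LEAF itself: B₁ = 5dLB₀ explicit, the threshold existential -/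

/-- **Proposition 2 at B₁ = 5dLB₀ with an existential threshold, from the node's own antecedent b8**: the faithful [6] leaf
`DagBinding.B8LeafR` carries `t4 : B8.Thm4Printed X.B₁'` and `p3 : B8.Prop3Printed X.d8 X.L8 X.C₂ X.inp8 X.B₀β` (thresholds ∃); with the (1.65) law
at some c₀, [6]'s displayed carrier laws and the bridges, `B8Thm2AtConstants.thm2_schedule_threshold_exists` supplies a scheduled c₁ > 0 and §2
gives `Prop2Printed (5dLB₀) Z.B₃ Z.C₁ c₁ Z.famLG`. [cite: Balaban1985Variational, Prop. 2 p.281, p.296; Balaban1985RegularSpaces, Thm 4 p.88, Prop. 3 p.87] -/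
theorem prop2At_exists_of_b8 (hb8 : (Upstream.ofPrintedAllXPN X Y Z V W).b8) (φ : Z.I11 → X.I8b)
    (β62 : ∀ i, Bridge62 (X.fam8R (φ i)).toGFData (Z.famLG i)) (laws62 : ∀ i, (β62 i).Laws Z.C₁ Z.B₃) (hC₁ : 0 < Z.C₁)
    {c₀ : ℝ} (hc₀ : 0 < c₀) (hd : 1 ≤ X.d8) (hB : 0 < X.B₁') (hC₂ : 0 ≤ X.C₂)
    (h165 : ∀ j α₀ α₁ (U₀ : (X.fam8R j).Cfg) (U' : (X.fam8R j).Pert), 0 < α₀ → α₀ ≤ c₀ →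
      (X.fam8R j).InA α₀ U₀ → (X.fam8R j).InAAx α₀ U₀ U' → (X.fam8R j).avgClose α₁ U₀ U' →
      (X.fam8R j).avgClose166 (11 * X.d8 ^ 2 * α₀ + α₁) U₀ U')
    (hginv : ∀ j α₀ (U₀ : (X.fam8R j).Cfg) (U' : (X.fam8R j).Pert) (u : (X.fam8R j).GT),
      (X.fam8R j).InAAx α₀ U₀ U' → (X.fam8R j).InAPair α₀ U₀ ((X.fam8R j).act U' u))
    (h137 : ∀ j α₁ b s (U₀ : (X.fam8R j).Cfg) (U' : (X.fam8R j).Pert) (u : (X.fam8R j).GT), (X.fam8R j).avgClose α₁ U₀ U' →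
      (X.fam8R j).Restricted U₀ u → (X.fam8R j).C162 b s U₀ ((X.fam8R j).act U' u) → (X.fam8R j).C137 α₁ U₀ ((X.fam8R j).act U' u))
    (hmono162 : ∀ j b s b' s' (U₀ : (X.fam8R j).Cfg) (U₁ : (X.fam8R j).Pert), b * s ≤ b' * s' →
      (X.fam8R j).C162 b s U₀ U₁ → (X.fam8R j).C162 b' s' U₀ U₁) :
    ∃ c₁ : ℝ, 0 < c₁ ∧ Prop2Printed (5 * X.d8 * X.L8 * X.inp8.B₀) Z.B₃ Z.C₁ c₁ Z.famLG := by
  obtain ⟨c₄, hc₄, h4⟩ := hb8.t4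
  obtain ⟨c₃, hc₃, h3⟩ := hb8.p3
  have hd' : (0 : ℝ) ≤ X.d8 := by positivity
  obtain ⟨c₁, hc₁, e₀, e₄, e₃, e₃', eD⟩ := B8Thm2AtConstants.thm2_schedule_threshold_exists hd' hc₀ hc₃ hc₄ hB hC₂
  exact ⟨c₁, hc₁, prop2At_of_b8_bodies X Z φ β62 laws62 hC₁ hd hB hC₂ e₀ e₄ e₃ e₃' eD h4 h3 h165 hginv h137 hmono162⟩

end Edge

/-! ## §4. The node N07 with Proposition 2 supplied by the B8 side at constants -/

/-- **THE NODE N07 FROM THE PRINTED PARTS WITH PROP 2 FROM [6]'s THEOREM 4 / PROPOSITION 3 BODIES**: as `B11LeafKnit.b11_main_of_parts`, the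
input p2 replaced by the B8-side data of `prop2_of_b8_bodies_le` (bodies at explicit thresholds on the run's `X.fam8R`, the p. 88 schedule, the
bridges of pp. 280–281, and the pin relations `5dLB₀ ≤ Z.B₁`, `Z.c₁ ≤ c₁`).  Nothing is discharged (B8 and B11 groups free at Stages 1–3).
[cite: Balaban1985Variational, Thm 1 p.279, Prop. 2 p.281, Props 3–9 pp.289–309; Balaban1985RegularSpaces, p.88] -/
theorem b11_main_of_parts_b8bodies (w : WorldP) (P : B12.RunParams) (X : PrintedCarriersR) (Y : PrintedCarriers9X)
    (Z : PrintedCarriers11) (V : PrintedCarriers14R) (W : PrintedCarriers15) (hP : w.up P = Upstream.ofPrintedAllXPN X Y Z V W)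
    (φ : Z.I11 → X.I8b) (β62 : ∀ i, Bridge62 (X.fam8R (φ i)).toGFData (Z.famLG i)) (laws62 : ∀ i, (β62 i).Laws Z.C₁ Z.B₃)
    {c₀ c₃ c₄ c₁ : ℝ} (hd : 1 ≤ X.d8) (hB : 0 < X.B₁') (hC₂ : 0 ≤ X.C₂)
    (e₀ : c₁ ≤ c₀) (e₄ : (1 + 11 * (X.d8 : ℝ) ^ 2) * c₁ ≤ c₄) (e₃ : c₁ ≤ c₃) (e₃' : X.B₁' * (1 + 11 * (X.d8 : ℝ) ^ 2) * c₁ ≤ c₃)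
    (eD : (X.B₁' * (1 + 11 * (X.d8 : ℝ) ^ 2) * (2 * (1 + X.C₂) * X.B₁' * (1 + 11 * (X.d8 : ℝ) ^ 2) + 20 * X.d8) + 1) * c₁ ≤ 1)
    (h4 : B8.Thm4Body c₄ X.B₁' (fun j : X.I8b => (X.fam8R j).toGFData))
    (h3 : B8.Prop3Body c₃ X.d8 X.L8 X.C₂ X.inp8 X.B₀β (fun j : X.I8b => (X.fam8R j).toGFData2))
    (h165 : ∀ j α₀ α₁ (U₀ : (X.fam8R j).Cfg) (U' : (X.fam8R j).Pert), 0 < α₀ → α₀ ≤ c₀ →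
      (X.fam8R j).InA α₀ U₀ → (X.fam8R j).InAAx α₀ U₀ U' → (X.fam8R j).avgClose α₁ U₀ U' →
      (X.fam8R j).avgClose166 (11 * X.d8 ^ 2 * α₀ + α₁) U₀ U')
    (hginv : ∀ j α₀ (U₀ : (X.fam8R j).Cfg) (U' : (X.fam8R j).Pert) (u : (X.fam8R j).GT),
      (X.fam8R j).InAAx α₀ U₀ U' → (X.fam8R j).InAPair α₀ U₀ ((X.fam8R j).act U' u))
    (h137 : ∀ j α₁ b s (U₀ : (X.fam8R j).Cfg) (U' : (X.fam8R j).Pert) (u : (X.fam8R j).GT), (X.fam8R j).avgClose α₁ U₀ U' →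
      (X.fam8R j).Restricted U₀ u → (X.fam8R j).C162 b s U₀ ((X.fam8R j).act U' u) → (X.fam8R j).C137 α₁ U₀ ((X.fam8R j).act U' u))
    (hmono162 : ∀ j b s b' s' (U₀ : (X.fam8R j).Cfg) (U₁ : (X.fam8R j).Pert), b * s ≤ b' * s' →
      (X.fam8R j).C162 b s U₀ U₁ → (X.fam8R j).C162 b' s' U₀ U₁)
    (hZB₁ : 5 * X.d8 * X.L8 * X.inp8.B₀ ≤ Z.B₁) (hZc₁ : Z.c₁ ≤ c₁)
    (β : ∀ i, Bridge (Z.famX i) (Z.famLG i)) {O₁ O₂ e₅ a : ℝ}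
    (laws : ∀ i, (β i).Laws Z.C₁ Z.B₃) (leaves : ∀ i, ExistenceLeavesCap (β i) Z.B₀ Z.B₃ Z.C₁ O₁ O₂ e₅)
    (plaws : ∀ i, (Z.famX i).Laws)
    (hB₀ : 0 < Z.B₀) (hB₁ : 0 < Z.B₁) (hB₃ : 1 ≤ Z.B₃) (hC₁ : 1 ≤ Z.C₁) (hB₀B₁ : Z.B₀ ≤ 4 * Z.B₁) (hc₁ : 0 < Z.c₁)
    (hO₁ : 0 < O₁) (hO₂ : 0 < O₂) (he₅ : 0 < e₅) (ha : 0 < a)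
    (hbg : ∀ (i : Z.I11) (ε₁ : ℝ) (V : (Z.famX i).Bdry), 0 < ε₁ → ε₁ ≤ a → (Z.famX i).Reg7 ε₁ V →
      ∃ U₀ : (Z.famLG i).Cfg, (Z.famLG i).Sat14 (Z.C₁ * Z.B₃ * ε₁) (Z.C₁ * ε₁) ((β i).bdry V) U₀)
    (hV : Z.famV = fun i => (Z.famX i).toVarProblem)
    (p3 : Prop3Printed Z.C₁ Z.B₃ Z.C₂ Z.C₃ Z.B₀ Z.c1h Z.c₄ Z.δ₀ Z.famLG)
    (p4 : Prop4Printed Z.C₁ Z.B₃ Z.famLG) (p5 : Prop5Printed Z.B₁ Z.B₃ Z.C₁ Z.famLG) (p6 : Prop6Printed Z.B₀ Z.B₃ Z.C₁ Z.famLG)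
    (p8 : Prop8Printed Z.B₃ Z.famX) (sF : SectFPrinted Z.B₃ Z.famX) (p9 : Prop9Printed Z.B₅ Z.C₁ Z.β₀ Z.δ₀ Z.famAn) :
    Dag.B11_main (leavesP w P) :=
  B11LeafKnit.b11_main_of_parts w P X Y Z V W hP β laws leaves plaws hB₀ hB₁ hB₃ hC₁ hB₀B₁ hc₁ hO₁ hO₂ he₅ ha hbg hV
    (prop2_of_b8_bodies_le X Z φ β62 laws62 (lt_of_lt_of_le one_pos hC₁) hd hB hC₂ e₀ e₄ e₃ e₃' eD h4 h3 h165 hginv h137 hmono162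
      hZB₁ hZc₁) p3 p4 p5 p6 p8 sF p9

end Literature.MathematicalPhysics.QuantumFieldTheory.Balaban1983to89.B11LeafKnitB8Edge
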